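import Mathlib.Geometry.Manifold.Instances.Sphere
import Mathlib.Geometry.Manifold.Diffeomorph
import Literature.Geometry.Lorentzian.Hypersurface
import Literature.Geometry.Riemannian.RoundSphere
import Literature.Topology.FourManifolds.Cobordism
import HarnessLib

/-!
# Admissible Riemannian fill-ins of a round sphere (topic `Geometry/Riemannian`)

Vocabulary for *fill-in* problems under a lower Ricci bound (Hang–Wang 2009, Miao–Wang 2016,
*Boundary effect of Ricci curvature*, J. Differential Geom. 103): a Riemannian manifold with boundary `(Δ, g)` whose boundary is, intrinsically, a ROUND sphere
of radius `r` and, extrinsically, has second fundamental form `II ≥ c · g|∂Δ` with respect to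
the OUTER unit normal. Definition request `defn-IsAdmissibleFillIn` of route
SmoothPoincare4/RicciFat (cruxes `NearExtremalFillIn`, `RicciFatBall`): "an ADMISSIBLE FILL-IN
is a compact connected smooth Riemannian 4-manifold with boundary `(Δ, g)` with `Ric_g ≥ 3g`,
`(∂Δ, g|∂Δ)` isometric to the round 3-sphere of radius `sin ρ₀`, and
`II_{∂Δ} ≥ −cot ρ₀ · g|∂Δ` (outer unit normal `ν`, `II(X,Y) = ⟨∇_X ν, Y⟩`, Hang–Wang 2009
p. 3)". Everything is stated for an `(n+1)`-manifold with boundary `Δ` modelled on `𝓡∂ (n + 1)`,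
a boundary datum `b : Literature.Topology.FourManifolds.BoundaryData (𝓡∂ (n + 1)) Δ (𝓡 n)`
(`b.carrier` the boundary `n`-manifold, `b.incl` its inclusion; `Cobordism.lean`) and a `C^∞`
metric `g : Literature.Geometry.Lorentzian.PseudoRiemannianMetric` on `TΔ` (a Mathlib
`Bundle.ContMDiffRiemannianMetric h` enters as `PseudoRiemannianMetric.ofRiemannian h`); the
route's case is `n = 3`.

* `IsOutwardPointing v` — a tangent vector `v ∈ T_x K` of a manifold with boundary modelled on
  `𝓡∂ m` points OUT of `K`: its normal half-space coordinate is negative, `v 0 < 0` (Lee 2013,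
  Prop. 5.41: in boundary coordinates, inward-pointing iff the normal component is `> 0`,
  outward-pointing iff `< 0`; Mathlib's `EuclideanHalfSpace m = {y | 0 ≤ y 0}` puts the normal
  coordinate first, and `T_x K = ℝᵐ` is read in the chart at `x`). The same clause `(ν z) 0 < 0`
  renders "outward unit normal" in `Literature.Geometry.Riemannian.Sweeney2026_pscMeanConvex` and
  in route SmoothPoincare4/PscCorkFillIn.
* `IsOuterUnitNormal g b ν` — the field `ν` along `b.incl`
  (`Literature.Geometry.Lorentzian.NormalField`) is THE smooth outer unit normal of `∂Δ`: a unit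
  normal of sign `+1` (`PseudoRiemannianMetric.IsUnitNormal`, `Hypersurface.lean`), `C^∞` as a
  map `∂Δ → TΔ`, outward-pointing at every point.
* `HasRoundBoundary g b r` — `(∂Δ, g|∂Δ)` is isometric to the round `n`-sphere of radius `r`:
  there is a diffeomorphism `φ : b.carrier ≃ₘ 𝕊ⁿ` onto the unit sphere
  `𝕊ⁿ = Metric.sphere (0 : EuclideanSpace ℝ (Fin (n+1))) 1` (Mathlib's `𝓡 n` structure) with
  `b.incl^* g = φ^* (r² · g_round)` (`PseudoRiemannianMetric.inducedBilin`, `pullbackBilin`, the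
  tree's `Literature.Geometry.Riemannian.roundMetric`); `Sⁿ(r) = {|x| = r} ⊂ ℝⁿ⁺¹` is isometric
  to `(𝕊ⁿ, r² g_round)` by `x ↦ r x` (O'Neill 1983, Ch. 3, p. 57 and Def. 3.4).
* `HasBoundaryConvexityBound g b c` — for the outer unit normal `ν`, the second fundamental
  form `II = PseudoRiemannianMetric.secondFundamentalForm (𝓡 n) g b.incl ν` (convention (h) of
  `Hypersurface.lean`, `II_ν(v, w) = + g(D_v ν, d(incl) w)`, which IS Hang–Wang's
  `Π(X, Y) = ⟨∇_X ν, Y⟩` for the outer unit normal, arXiv:0911.0380 p. 3) satisfies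
  `II_y(v, v) ≥ c · (b.incl^* g)_y(v, v)` for all `y`, `v`.
* `IsAdmissibleFillIn g b r c := HasRoundBoundary g b r ∧ HasBoundaryConvexityBound g b c`.
* `HasRicciLowerBound g κ` — `Ric_g(v, v) ≥ κ g(v, v)` for all tangent vectors
  (`PseudoRiemannianMetric.ricci`, `LeviCivita.lean`); route RicciFat inlines the case `κ = 3`
  (`hasRicciLowerBound_ofRiemannian_iff`).

Models (signs and constants, Hang–Wang 2009 p. 3; not formalised here), fill-in of dimension
`n + 1`: the closed unit ball of `ℝⁿ⁺¹` has `r = 1`, `c = 1` (`ν = x`, `∇_X ν = X`); the geodesic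
ball `B_ρ` of the unit round `Sⁿ⁺¹` (`0 < ρ < π`) has boundary `Sⁿ(sin ρ)` with `II = cot ρ · g|∂`,
so `r = sin ρ`, `c = cot ρ` — the hemisphere has `c = 0` (and is the only `Ric ≥ n g` fill-in of
the unit `Sⁿ` with `II ≥ 0`, Hang–Wang 2009, Thm. 2), the big cap `B_{π-ρ₀}`, `0 < ρ₀ < π/2`,
has `r = sin ρ₀`, `c = -cot ρ₀ < 0` (the model of crux `NearExtremalFillIn`).

## Design choices (the API lemmas below are all proved)

* The metric is the tree's `PseudoRiemannianMetric`, so that `secondFundamentalForm`,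
  `inducedBilin`, `IsUnitNormal`, `ricci` apply verbatim; Riemannian-ness is NOT part of the
  predicates (items add `g.IsRiemannian`, or use `ofRiemannian h`, Riemannian by
  `isRiemannian_ofRiemannian`). The Levi-Civita standing hypothesis `[g.HasLeviCivita]` of
  `LeviCivita.lean` is an instance argument of `HasBoundaryConvexityBound`, `IsAdmissibleFillIn`,
  `HasRicciLowerBound`.
* The outer unit normal is existentially quantified together with its smoothness (as in
  `Sweeney2026_pscMeanConvex`): for a Riemannian `g` it is unique and automatically smooth, so
  "`∃ ν, IsOuterUnitNormal g b ν ∧ …`" and "the outer unit normal satisfies …" agree, and the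
  smoothness makes the named fact `secondFundamentalForm_apply` applicable to any witness.
* `HasRoundBoundary` uses the unit sphere and the factor `r²` (Mathlib's manifold structure
  exists on unit spheres only); `r` and `-r` give the same condition and `0 < r` is left to the
  user (route: `r = sin ρ₀`). The `Fact (finrank ℝ ℝⁿ⁺¹ = n + 1)` feeding `roundMetric` is
  registered inside the definition (`finrank_euclideanSpace_fin`, as in `HarmonicTwoSpheres.lean`);
  lemmas mentioning `roundMetric` take it as an instance hypothesis (any two agree by proof
  irrelevance).
* No compactness, connectedness or dimension restriction is built in (hypotheses of theorems, not
  of the notion); the volume is `Literature.Geometry.Lorentzian.riemannianMeasure` (`Volume.lean`).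
  NOT here: existence/smoothness of the outer unit normal, the model computations, `H ≥ n c`,
  Hang–Wang's Thms. 2–3, the Heintze–Karcher / Kasue volume comparison (separate cite items).

## References

* F. Hang, X. Wang, *Rigidity theorems for compact manifolds with boundary and positive Ricci
  curvature*, J. Geom. Anal. 19 (2009) 628–642 = arXiv:0911.0380: p. 3 (conventions: "Let `ν` be
  the outer unit normal field of `Σ` in `M` … `Π(X,Y) = ⟨∇_X ν, Y⟩`. The mean curvature is the
  trace of the second fundamental form"), Thm. 2 (`Ric ≥ (n-1)g`, boundary isometric to `Sⁿ⁻¹`,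
  `Π ≥ 0` ⇒ hemisphere), Thm. 3 (`Π ≥ Π₀ ∘ ι`). Read: `lit read arxiv:0911.0380`, p0003.
  [HangWang2009]
* B. O'Neill, *Semi-Riemannian geometry* (1983), Ch. 3, Def. 3.4 and p. 57 (round spheres
  `Sⁿ(r)`), Ch. 4, pp. 97–107 (induced metric, shape tensor, sign of a hypersurface). [ONeill1983]
* J. M. Lee, *Introduction to Smooth Manifolds*, 2nd ed. (2013), Prop. 5.41 and p. 118
  (inward/outward-pointing vectors in boundary charts). [LeeSmoothManifolds2013]
-/

noncomputable section

open Bundle Set Metric Module Function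
open scoped Manifold ContDiff Topology RealInnerProductSpace

namespace Literature.Geometry.Riemannian

open Lorentzian Lorentzian.PseudoRiemannianMetric
open Literature.Topology.FourManifolds (BoundaryData)

/-- Local notation: `𝔼 n` is the model Euclidean space `EuclideanSpace ℝ (Fin n)`. -/
local notation "𝔼 " n:arg => EuclideanSpace ℝ (Fin n)

universe u

/-! ### Outward-pointing vectors on a manifold with boundary -/

section Outward

variable {m : ℕ} [NeZero m] {K : Type*} [TopologicalSpace K]
  [ChartedSpace (EuclideanHalfSpace m) K]

/-- A tangent vector `v ∈ T_x K` of a manifold with boundary `K` modelled on the half-space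
`EuclideanHalfSpace m = {y : ℝᵐ | 0 ≤ y 0}` (model with corners `𝓡∂ m`) is **outward-pointing**
if its normal half-space coordinate is negative, `v 0 < 0`. In Mathlib's formalism `T_x K = ℝᵐ`
is read in the preferred chart at `x`, which maps into `{y | 0 ≤ y 0}` and sends boundary points
to `{y | y 0 = 0}`; at a boundary point `x` this is Lee's characterisation (Lee 2013, Prop. 5.41
and p. 118: inward-pointing iff the normal component is `> 0`, outward-pointing iff `< 0`;
Mathlib puts the normal coordinate first). At interior points the predicate has no geometric
meaning and is not used. Compare `Literature.Topology.FourManifolds.inwardUnit` (`e₀`) and the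
clause `(ν z) 0 < 0` of `Literature.Geometry.Riemannian.Sweeney2026_pscMeanConvex`.
[cite: LeeSmoothManifolds2013, Prop. 5.41 and p. 118] -/
def IsOutwardPointing {x : K} (v : TangentSpace (𝓡∂ m) x) : Prop :=
  (show 𝔼 m from v) 0 < 0

/-- `v` is outward-pointing iff its `0`-th half-space coordinate is negative. [folklore] -/
@[simp]
theorem isOutwardPointing_iff {x : K} (v : TangentSpace (𝓡∂ m) x) :
    IsOutwardPointing v ↔ (show 𝔼 m from v) 0 < 0 :=
  Iff.rfl

/-- The zero vector is not outward-pointing. [folklore] -/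
theorem not_isOutwardPointing_zero (x : K) : ¬ IsOutwardPointing (0 : TangentSpace (𝓡∂ m) x) :=
  fun h ↦ lt_irrefl (0 : ℝ) h

end Outward

/-! ### Fill-in data: outer unit normal, round boundary, convexity bound -/

section FillIn

variable {n : ℕ} {Δ : Type u} [TopologicalSpace Δ] [ChartedSpace (EuclideanHalfSpace (n + 1)) Δ]
  [IsManifold (𝓡∂ (n + 1)) ∞ Δ]
  (g : PseudoRiemannianMetric (𝓡∂ (n + 1)) ∞ (𝔼 (n + 1))
    (TangentSpace (𝓡∂ (n + 1)) : Δ → Type _))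
  (b : BoundaryData (𝓡∂ (n + 1)) Δ (𝓡 n))

/-- `ν` is **the smooth outer unit normal** of the boundary `∂Δ` (boundary datum `b`, inclusion
`b.incl : b.carrier → Δ`) in `(Δ, g)`: a unit normal field of sign `+1` along `b.incl`
(`g(ν, d(incl) v) = 0`, `g(ν, ν) = 1`; `PseudoRiemannianMetric.IsUnitNormal`, `Hypersurface.lean`)
which is `C^∞` as a map `∂Δ → TΔ` and outward-pointing at every point (`IsOutwardPointing`:
first half-space coordinate negative). For a Riemannian `g` such a field is unique (the
`g`-normal line of the boundary hyperplane meets each open half-space in one unit vector).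
Hang–Wang 2009, p. 3 ("Let `ν` be the outer unit normal field of `Σ` in `M`"); O'Neill 1983,
Ch. 4, pp. 106–107. [cite: HangWang2009, p. 3 (conventions)] -/
structure IsOuterUnitNormal (ν : NormalField (𝓡∂ (n + 1)) b.incl) : Prop where
  /-- `ν` is a unit normal of sign `+1` along the boundary inclusion. -/
  isUnitNormal : g.IsUnitNormal (𝓡 n) b.incl ν 1
  /-- `ν` is smooth as a map `∂Δ → TΔ`. -/
  contMDiff : ContMDiff (𝓡 n) (𝓡∂ (n + 1)).tangent ∞
    (fun z ↦ (TotalSpace.mk' (𝔼 (n + 1)) (b.incl z) (ν z) : TangentBundle (𝓡∂ (n + 1)) Δ))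
  /-- `ν` points out of `Δ` at every boundary point. -/
  isOutwardPointing : ∀ z, IsOutwardPointing (ν z)

variable {g b} in
/-- The outer unit normal is normal to the boundary: `g(ν z, d(incl)_z v) = 0`.
[cite: HangWang2009, p. 3 (conventions)] -/
theorem IsOuterUnitNormal.val_mfderiv {ν : NormalField (𝓡∂ (n + 1)) b.incl}
    (h : IsOuterUnitNormal g b ν) (z : b.carrier) (v : TangentSpace (𝓡 n) z) :
    g.val (b.incl z) (ν z) (mfderiv (𝓡 n) (𝓡∂ (n + 1)) b.incl z v) = 0 :=
  h.isUnitNormal.isNormalTo z v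

variable {g b} in
/-- The outer unit normal has unit length: `g(ν z, ν z) = 1`.
[cite: HangWang2009, p. 3 (conventions)] -/
theorem IsOuterUnitNormal.val_self {ν : NormalField (𝓡∂ (n + 1)) b.incl}
    (h : IsOuterUnitNormal g b ν) (z : b.carrier) : g.val (b.incl z) (ν z) (ν z) = 1 :=
  h.isUnitNormal.val_self z

/-- **Round boundary of radius `r`.** The boundary `(∂Δ, g|∂Δ)` is isometric to the round
`n`-sphere of radius `r`: there is a diffeomorphism `φ` of the boundary manifold `b.carrier` onto
the unit sphere `𝕊ⁿ = sphere (0 : ℝⁿ⁺¹) 1` (Mathlib's `𝓡 n`-manifold structure) under which the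
induced (first fundamental) form `b.incl^* g` (`PseudoRiemannianMetric.inducedBilin`) is the
pullback of `r²` times the round metric `g_round` (`Literature.Geometry.Riemannian.roundMetric`):
`(b.incl^* g)_y = r² · (φ^* g_round)_y` for every `y`. Since `x ↦ r x` is an isometry
`(𝕊ⁿ, r² g_round) ≅ Sⁿ(r) = {|x| = r} ⊂ ℝⁿ⁺¹` (O'Neill 1983, Ch. 3, p. 57, Def. 3.4), this is
"`(Σ, g|_Σ)` is isometric to the standard sphere (of radius `r`)" (Hang–Wang 2009, Thm. 2,
`r = 1`). The dimension fact `finrank ℝ ℝⁿ⁺¹ = n + 1` under which `roundMetric` applies to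
`𝕊ⁿ ⊂ ℝⁿ⁺¹` is registered on the spot. [cite: HangWang2009, Thm. 2 (boundary isometry)] -/
def HasRoundBoundary (r : ℝ) : Prop :=
  haveI : Fact (finrank ℝ (𝔼 (n + 1)) = n + 1) := ⟨finrank_euclideanSpace_fin⟩
  ∃ φ : b.carrier ≃ₘ⟮𝓡 n, 𝓡 n⟯ sphere (0 : 𝔼 (n + 1)) 1,
    ∀ y : b.carrier, g.inducedBilin (𝓡 n) b.incl y =
      r ^ 2 • pullbackBilin (I := 𝓡 n) (I' := 𝓡 n) φ (roundMetric (n := n) (𝔼 (n + 1))).val y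

variable [g.HasLeviCivita]

/-- **Convexity bound `II ≥ c · g|∂Δ` for the outer unit normal.** There is a smooth outer unit
normal `ν` of `∂Δ` in `(Δ, g)` (`IsOuterUnitNormal`; unique when it exists) whose second
fundamental form `II_ν = secondFundamentalForm (𝓡 n) g b.incl ν` — convention
`II_ν(v, w) = + g(D_v ν, d(incl) w)` of `Hypersurface.lean`, i.e. Hang–Wang's
`Π(X, Y) = ⟨∇_X ν, Y⟩` for the OUTER unit normal (round spheres bounding balls are convex,
`Π > 0`) — is bounded below by `c` times the induced metric:
`c · (b.incl^* g)_y(v, v) ≤ II_y(v, v)` for all `y ∈ ∂Δ`, `v ∈ T_y ∂Δ`. Hang–Wang 2009, p. 3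
and Thm. 2 (`c = 0`: "`Σ` is convex in `M` in the sense that its second fundamental form is
nonnegative"), Thm. 3 (`Π ≥ Π₀ ∘ ι`). [cite: HangWang2009, p. 3 and Thms. 2–3] -/
def HasBoundaryConvexityBound (c : ℝ) : Prop :=
  ∃ ν : NormalField (𝓡∂ (n + 1)) b.incl, IsOuterUnitNormal g b ν ∧
    ∀ (y : b.carrier) (v : TangentSpace (𝓡 n) y),
      c * g.inducedBilin (𝓡 n) b.incl y v v ≤ g.secondFundamentalForm (𝓡 n) b.incl ν y v v

/-- **Admissible fill-in with parameters `(r, c)`** (definition request of route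
SmoothPoincare4/RicciFat, cruxes `NearExtremalFillIn` / `RicciFatBall`): the Riemannian manifold
with boundary `(Δ, g)` (boundary datum `b`) has boundary isometric to the round `n`-sphere of
radius `r` (`HasRoundBoundary`) and second fundamental form `II ≥ c · g|∂Δ` with respect to the
outer unit normal (`HasBoundaryConvexityBound`, Hang–Wang's `Π(X,Y) = ⟨∇_X ν, Y⟩`). Models: the
closed unit ball of `ℝⁿ⁺¹` (`r = 1`, `c = 1`); the geodesic ball `B_ρ ⊂ Sⁿ⁺¹(1)` (`r = sin ρ`,
`c = cot ρ`), in particular the big cap `B_{π-ρ₀}` (`r = sin ρ₀`, `c = -cot ρ₀`). The Ricci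
bound (`HasRicciLowerBound`), compactness, connectedness and the volume
(`Literature.Geometry.Lorentzian.riemannianMeasure`) are separate hypotheses of the statements
using this notion. [cite: HangWang2009, p. 3 and Thms. 2–3] -/
def IsAdmissibleFillIn (r c : ℝ) : Prop :=
  HasRoundBoundary g b r ∧ HasBoundaryConvexityBound g b c

end FillIn

/-! ### Ricci lower bounds -/

section Ricci

variable {E : Type*} [NormedAddCommGroup E] [NormedSpace ℝ E] [FiniteDimensional ℝ E]
  [CompleteSpace E] {H : Type*} [TopologicalSpace H] {I : ModelWithCorners ℝ E H} {M : Type*}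
  [TopologicalSpace M] [ChartedSpace H M] [IsManifold I ∞ M] {n' : ℕ∞ω} [Fact (1 ≤ n')]
  (g : PseudoRiemannianMetric I n' E (TangentSpace I : M → Type _)) [g.HasLeviCivita]

/-- **Ricci curvature bounded below by `κ`**: `Ric_g(v, v) ≥ κ · g(v, v)` for every point `x`
and every tangent vector `v ∈ T_x M` (`PseudoRiemannianMetric.ricci` of `LeviCivita.lean`, the
Ricci tensor of the Levi-Civita connection). Hang–Wang 2009, Thm. 2 ("`Ric ≥ (n-1) g`"); route
SmoothPoincare4/RicciFat inlines the case `κ = 3` in dimension `4`. [cite: HangWang2009, Thm. 2] -/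
def HasRicciLowerBound (κ : ℝ) : Prop :=
  ∀ (x : M) (v : TangentSpace I x), κ * g.val x v v ≤ g.ricci x v v

omit [FiniteDimensional ℝ E] [CompleteSpace E] [Fact (1 ≤ n')] [g.HasLeviCivita] in
/-- For a Mathlib Riemannian metric `h`, `HasRicciLowerBound (ofRiemannian h) κ` is literally the
clause `∀ x v, κ * h.inner x v v ≤ (ofRiemannian h).ricci x v v` inlined by route
SmoothPoincare4/RicciFat (`κ = 3`). [folklore] -/
theorem hasRicciLowerBound_ofRiemannian_iff
    (h : ContMDiffRiemannianMetric I n' E (TangentSpace I : M → Type _))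
    [(ofRiemannian h).HasLeviCivita] (κ : ℝ) :
    HasRicciLowerBound (ofRiemannian h) κ ↔
      ∀ (x : M) (v : TangentSpace I x), κ * h.inner x v v ≤ (ofRiemannian h).ricci x v v :=
  Iff.rfl

omit [FiniteDimensional ℝ E] [CompleteSpace E] [Fact (1 ≤ n')] in
variable {g} in
/-- A Ricci lower bound weakens: for a Riemannian `g`, `Ric ≥ κ g` and `κ' ≤ κ` give
`Ric ≥ κ' g` (`g(v, v) ≥ 0`). [folklore] -/
theorem HasRicciLowerBound.mono (hg : g.IsRiemannian) {κ κ' : ℝ} (h : HasRicciLowerBound g κ)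
    (hκ : κ' ≤ κ) : HasRicciLowerBound g κ' := by
  intro x v
  have h0 : 0 ≤ g.val x v v := by
    by_cases hv : v = 0
    · simp [hv]
    · exact (hg x v hv).le
  exact (mul_le_mul_of_nonneg_right hκ h0).trans (h x v)

end Ricci

/-! ### API for the fill-in predicates -/

section FillInAPI

variable {n : ℕ} {Δ : Type u} [TopologicalSpace Δ] [ChartedSpace (EuclideanHalfSpace (n + 1)) Δ]
  [IsManifold (𝓡∂ (n + 1)) ∞ Δ]
  {g : PseudoRiemannianMetric (𝓡∂ (n + 1)) ∞ (𝔼 (n + 1))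
    (TangentSpace (𝓡∂ (n + 1)) : Δ → Type _)}
  {b : BoundaryData (𝓡∂ (n + 1)) Δ (𝓡 n)} {r c : ℝ}

/-- Unfolding of `HasRoundBoundary` (with the dimension `Fact` supplied by the context; any two
such instances agree definitionally). [folklore] -/
theorem hasRoundBoundary_iff [Fact (finrank ℝ (𝔼 (n + 1)) = n + 1)] :
    HasRoundBoundary g b r ↔
      ∃ φ : b.carrier ≃ₘ⟮𝓡 n, 𝓡 n⟯ sphere (0 : 𝔼 (n + 1)) 1,
        ∀ y : b.carrier, g.inducedBilin (𝓡 n) b.incl y =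
          r ^ 2 •
            pullbackBilin (I := 𝓡 n) (I' := 𝓡 n) φ (roundMetric (n := n) (𝔼 (n + 1))).val y :=
  Iff.rfl

/-- **The Euclidean form of a round boundary.** If `(∂Δ, g|∂Δ)` is round of radius `r` via `φ`,
then `g(d(incl) v, d(incl) w) = r² ⟪d(ι ∘ φ) v, d(ι ∘ φ) w⟫` with `ι : 𝕊ⁿ ↪ ℝⁿ⁺¹` the inclusion
(`roundMetric_apply` and the chain rule). [folklore] -/
theorem HasRoundBoundary.exists_inducedBilin_apply (h : HasRoundBoundary g b r) :
    ∃ φ : b.carrier ≃ₘ⟮𝓡 n, 𝓡 n⟯ sphere (0 : 𝔼 (n + 1)) 1,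
      ∀ (y : b.carrier) (v w : TangentSpace (𝓡 n) y),
        g.inducedBilin (𝓡 n) b.incl y v w =
          r ^ 2 * ⟪(mfderiv (𝓡 n) 𝓘(ℝ, 𝔼 (n + 1)) (Subtype.val ∘ φ) y v : 𝔼 (n + 1)),
            (mfderiv (𝓡 n) 𝓘(ℝ, 𝔼 (n + 1)) (Subtype.val ∘ φ) y w : 𝔼 (n + 1))⟫ := by
  haveI : Fact (finrank ℝ (𝔼 (n + 1)) = n + 1) := ⟨finrank_euclideanSpace_fin⟩
  obtain ⟨φ, hφ⟩ := h
  refine ⟨φ, fun y v w ↦ ?_⟩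
  have hcomp : mfderiv (𝓡 n) 𝓘(ℝ, 𝔼 (n + 1)) (Subtype.val ∘ φ) y =
      (mfderiv (𝓡 n) 𝓘(ℝ, 𝔼 (n + 1)) (Subtype.val : sphere (0 : 𝔼 (n + 1)) 1 → 𝔼 (n + 1))
        (φ y)).comp (mfderiv (𝓡 n) (𝓡 n) φ y) :=
    mfderiv_comp y ((contMDiff_coe_sphere (m := 1)).mdifferentiableAt one_ne_zero)
      (φ.contMDiff.mdifferentiableAt (by simp))
  rw [hφ y]
  simp only [FunLike.coe_smul, Pi.smul_apply, smul_eq_mul, pullbackBilin_apply, roundMetric_apply,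
    hcomp]
  rfl

/-- On a round boundary the induced form is positive semi-definite:
`(b.incl^* g)_y(v, v) = r² ‖d(ι ∘ φ) v‖² ≥ 0`. [folklore] -/
theorem HasRoundBoundary.inducedBilin_self_nonneg (h : HasRoundBoundary g b r) (y : b.carrier)
    (v : TangentSpace (𝓡 n) y) : 0 ≤ g.inducedBilin (𝓡 n) b.incl y v v := by
  obtain ⟨φ, hφ⟩ := h.exists_inducedBilin_apply
  rw [hφ y v v, real_inner_self_eq_norm_sq]
  positivity

/-- **No round boundary without boundary.** If the boundary manifold is empty (e.g. `Δ` is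
boundaryless, `BoundaryData.isEmpty_carrier`) then `HasRoundBoundary g b r` fails, the sphere
being nonempty: the round-boundary condition is not vacuous. [folklore] -/
theorem not_hasRoundBoundary_of_isEmpty [IsEmpty b.carrier] : ¬ HasRoundBoundary g b r := by
  rintro ⟨φ, -⟩
  have p : sphere (0 : 𝔼 (n + 1)) 1 :=
    ⟨EuclideanSpace.single 0 1, by simp⟩
  exact IsEmpty.false (φ.symm p)

/-- No round boundary on a boundaryless manifold. [folklore] -/
theorem not_hasRoundBoundary_of_boundarylessManifold [BoundarylessManifold (𝓡∂ (n + 1)) Δ] :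
    ¬ HasRoundBoundary g b r :=
  haveI := b.isEmpty_carrier
  not_hasRoundBoundary_of_isEmpty

/-- **Link with isometries of metrics.** For a spacelike boundary inclusion (`hf`, so that the
induced metric `b.incl^* g` is a `PseudoRiemannianMetric`, `inducedMetric`) and `r ≠ 0`, the
boundary is round of radius `r` iff some diffeomorphism `φ : ∂Δ ≃ 𝕊ⁿ` is an isometry
(`PseudoRiemannianMetric.IsIsometry`, `Isometry.lean`) from `(∂Δ, b.incl^* g)` onto
`(𝕊ⁿ, r² · g_round)` (`PseudoRiemannianMetric.constSmul`).
[cite: ONeill1983, Ch. 3, Def. 3.4 (p. 58)] -/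
theorem hasRoundBoundary_iff_isIsometry [Fact (finrank ℝ (𝔼 (n + 1)) = n + 1)]
    (hf : g.IsSpacelikeImmersion (𝓡 n) b.incl) (hr : r ≠ 0) :
    HasRoundBoundary g b r ↔
      ∃ φ : b.carrier ≃ₘ⟮𝓡 n, 𝓡 n⟯ sphere (0 : 𝔼 (n + 1)) 1,
        IsIsometry (g.inducedMetric b.incl contMDiff_pullbackBilin_holds hf)
          ((roundMetric (n := n) (𝔼 (n + 1))).constSmul (r ^ 2) (pow_ne_zero 2 hr)) φ := by
  rw [hasRoundBoundary_iff]
  refine exists_congr fun φ ↦ forall_congr' fun y ↦ ?_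
  have key : pullbackBilin (I := 𝓡 n) (I' := 𝓡 n) φ
      ((roundMetric (n := n) (𝔼 (n + 1))).constSmul (r ^ 2) (pow_ne_zero 2 hr)).val y =
      r ^ 2 •
        pullbackBilin (I := 𝓡 n) (I' := 𝓡 n) φ (roundMetric (n := n) (𝔼 (n + 1))).val y := by
    ext v w
    simp [pullbackBilin_apply]
  rw [inducedMetric_val, key, eq_comm]

variable [g.HasLeviCivita]

/-- Unfolding of `IsAdmissibleFillIn`. [folklore] -/
theorem isAdmissibleFillIn_iff :
    IsAdmissibleFillIn g b r c ↔ HasRoundBoundary g b r ∧ HasBoundaryConvexityBound g b c :=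
  Iff.rfl

/-- An admissible fill-in has round boundary. [folklore] -/
theorem IsAdmissibleFillIn.hasRoundBoundary (h : IsAdmissibleFillIn g b r c) :
    HasRoundBoundary g b r :=
  h.1

/-- An admissible fill-in satisfies the convexity bound. [folklore] -/
theorem IsAdmissibleFillIn.hasBoundaryConvexityBound (h : IsAdmissibleFillIn g b r c) :
    HasBoundaryConvexityBound g b c :=
  h.2

/-- The convexity bound weakens in `c` as soon as the induced form is positive semi-definite.
[folklore] -/
theorem HasBoundaryConvexityBound.mono {c' : ℝ} (h : HasBoundaryConvexityBound g b c)
    (hpos : ∀ (y : b.carrier) (v : TangentSpace (𝓡 n) y),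
      0 ≤ g.inducedBilin (𝓡 n) b.incl y v v) (hc : c' ≤ c) : HasBoundaryConvexityBound g b c' := by
  obtain ⟨ν, hν, hII⟩ := h
  exact ⟨ν, hν, fun y v ↦ (mul_le_mul_of_nonneg_right hc (hpos y v)).trans (hII y v)⟩

/-- **Admissibility is monotone in `c`**: an admissible fill-in with parameters `(r, c)` is
admissible with parameters `(r, c')` for every `c' ≤ c` (the induced form of a round boundary is
positive semi-definite). [folklore] -/
theorem IsAdmissibleFillIn.mono {c' : ℝ} (h : IsAdmissibleFillIn g b r c) (hc : c' ≤ c) :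
    IsAdmissibleFillIn g b r c' :=
  ⟨h.1, h.2.mono h.1.inducedBilin_self_nonneg hc⟩

end FillInAPI

end Literature.Geometry.Riemannian

end
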